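import Summits.ABC.ABC.Theorems.TwoSixPencilPencilBoundEngine
import Summits.ABC.ABC.Theses.TwoSixPencil
import HarnessLib

/-!
# Crux `PencilBound` (stmt-ABC-24782, route `TwoSixPencil`) — THE GENERAL PENCIL THEOREM, proved

`Summits/ABC/ABC/Theorems/TwoSixPencilPencilBound.lean`: the route decl
`Summit.ABC.ABC.Theses.TwoSixPencil.PencilBound` (for every `k ≥ 3`, pairwise non-proportional
integral linear forms `Lᵢ = aᵢu + bᵢw`, coprime `(u, w)` with `∏ Lᵢ(u,w) ≠ 0`:
`log max(|u|,|w|) ≤ C(ε, forms) · rad(∏ Lᵢ(u,w))^{1/k+ε}`) is, after unfolding, literally the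
engine theorem `Summit.ABC.ABC.Theorems.pencil_log_height_le_rad_rpow`
(file `TwoSixPencilPencilBoundEngine.lean`; per-member transfer of Stewart–Yu 2001 Thm 2 in
`TwoSixPencilPencilBoundMember.lean`).

HONESTY: corollary of the PROVED `stewartYu2001_thm2_holds`; the class ε-shapes it serves
(`TwoSixClassEpsShape`, exponent `1/6`; `SixTorsionClassEpsShape`, exponent `1/4`) are NOT abc,
NOT A-PS (polynomial Szpiro), NOT rung A1′; the routes reach `ABC` only through their DECLARED
RESIDUALS. [cite: StewartYu2001, Theorem 2]
-/

set_option linter.dupNamespace false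

namespace Summit.ABC.ABC.Theorems

/-- **Crux `PencilBound` (stmt-ABC-24782) — proved.** `∀ k ≥ 3`, pairwise non-proportional
integral forms, coprime `(u, w)`, nonzero product ⇒
`log max(|u|,|w|) ≤ C(ε, forms) · rad(∏ Lᵢ)^{1/k+ε}`; by `pencil_log_height_le_rad_rpow`
(Stewart–Yu 2001 Thm 2 on the sub-pencil through the member of least largest prime factor).
Its `k = 4` instance is `RationalCuspPencil.PencilFourBound` (stmt-ABC-24549). NOT abc, NOT A-PS,
NOT A1′. [cite: StewartYu2001, Theorem 2 and the remark after it] -/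
theorem pencilBound_proof : Summit.ABC.ABC.Theses.TwoSixPencil.PencilBound := by
  unfold Summit.ABC.ABC.Theses.TwoSixPencil.PencilBound
  exact pencil_log_height_le_rad_rpow

end Summit.ABC.ABC.Theorems
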